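import Summits.SmoothPoincare4.SmoothPoincare4.Theorems.SullivanDualHyperbolicEndTaubesModelDefs

/-!
# Route `SullivanDual`, crux `HyperbolicEnd` (stmt-SmoothPoincare4-7825), line `taubes-circle-pencil`:
# the algebraic identities of Taubes' untwisted model

Registered `helper_…` statements of the crux item, all Σ-free and about the explicit formulas of
`Theorems/SullivanDualHyperbolicEndTaubesModelDefs.lean` on the punctured flat tube
`taubesTube δ ∖ taubesCore`, `0 < δ < 1` (Taubes, Geom. Topol. 2 (1998), §1: the form
`ωT = dt ∧ dQ + ⋆dQ` and its singular metric almost complex structure `J♭`):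

* `helper_taubesR_pos`, `helper_taubesGrad_pos` — the tube misses the axis; `|∇Q| > 0` off the core;
* `helper_taubesJ_sq` — `J♭² = −1`;
* `helper_taubesForm_taubesJ` — COMPATIBILITY `ωT(u, J♭v) = |∇Q| · g_tor(u, v)`, whence
  `helper_taubesForm_tame` — `ωT(u, J♭u) > 0` for `u ≠ 0` (this is why the pencil's `J = Ψᵢ_* J♭` is
  `sf`-tame at every point of the punctured tubes, the clause `IsPinnedStructure.tame` there);
* `helper_taubesForm_swap` — `ωT` is alternating;
* `helper_taubesJ_dt` — `J♭ ∂_t = ∇Q/|∇Q|`; `helper_taubesJ_horizontal` — `ker dt ∩ ker dQ` is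
  `J♭`-invariant (the sheets `{t₀} × {Q = c}` are `J♭`-holomorphic: the fold-type wall leaves of the
  line card).

Method: every identity is reduced to the toroidal components `(dt, da, dy₂, dy₃)` — the frame
`(∂_t, ∂_a, e₂, e₃)` is `g_tor`-orthonormal and `J♭` acts on components by the constant quaternionic
matrix `(a K₁ + b K₂ − 2c K₃)/m`, `m² = a² + b² + 4c²` — and closed by `field_simp` +
`linear_combination` against `r² = y₀² + y₁²`, `m² = a² + b² + 4c²`.  Closedness `dωT = 0` (needs the
form as a `ContinuousAlternatingMap`-valued field) is deliberately not here.
-/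

-- the registered namespace `Summit.SmoothPoincare4.SmoothPoincare4.…` repeats a component (P = Sub)
set_option linter.dupNamespace false

noncomputable section

open Set

namespace Summit.SmoothPoincare4.SmoothPoincare4.Cruxes.HyperbolicEnd.TaubesCirclePencil

/-! ### Positivity on the punctured tube -/

/-- On a tube of radius `< 1` the distance from the axis is positive. [folklore] -/
theorem helper_taubesR_pos :
    ∀ (δ : ℝ) (y : EuclideanSpace ℝ (Fin 4)), 0 < δ → δ < 1 → y ∈ taubesTube δ → 0 < taubesR y := by
  intro δ y hδ0 hδ hy
  rw [mem_taubesTube] at hy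
  by_contra h
  have h0 : taubesR y = 0 := le_antisymm (not_lt.mp h) (Real.sqrt_nonneg _)
  have h1 : (1 : ℝ) ≤ (taubesR y - 1) ^ 2 + y 2 ^ 2 + y 3 ^ 2 := by
    rw [h0]; nlinarith [sq_nonneg (y 2), sq_nonneg (y 3)]
  have h2 : δ ^ 2 < 1 := by nlinarith
  linarith

/-- `taubesR y ^ 2 = y₀² + y₁²`. [folklore] -/
theorem taubesR_sq (y : EuclideanSpace ℝ (Fin 4)) : taubesR y ^ 2 = y 0 ^ 2 + y 1 ^ 2 :=
  Real.sq_sqrt (by positivity)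

/-- `taubesGrad y ^ 2 = a² + b² + 4c²`. [folklore] -/
theorem taubesGrad_sq (y : EuclideanSpace ℝ (Fin 4)) :
    taubesGrad y ^ 2 = (taubesR y - 1) ^ 2 + y 2 ^ 2 + 4 * y 3 ^ 2 :=
  Real.sq_sqrt (by positivity)

/-- Off the core circle (and off the axis) Taubes' gradient `|∇Q|` is positive. [folklore] -/
theorem helper_taubesGrad_pos :
    ∀ (δ : ℝ) (y : EuclideanSpace ℝ (Fin 4)), 0 < δ → δ < 1 → y ∈ taubesTube δ → y ∉ taubesCore →
      0 < taubesGrad y := by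
  intro δ y hδ0 hδ hy hc
  have hr := helper_taubesR_pos δ y hδ0 hδ hy
  rw [taubesGrad]
  apply Real.sqrt_pos.mpr
  by_contra h'
  have h := not_lt.mp h'
  have ha : (taubesR y - 1) ^ 2 = 0 := by nlinarith [sq_nonneg (taubesR y - 1), sq_nonneg (y 2), sq_nonneg (y 3)]
  have hb : y 2 ^ 2 = 0 := by nlinarith [sq_nonneg (taubesR y - 1), sq_nonneg (y 2), sq_nonneg (y 3)]
  have hc' : y 3 ^ 2 = 0 := by nlinarith [sq_nonneg (taubesR y - 1), sq_nonneg (y 2), sq_nonneg (y 3)]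
  have h1 : taubesR y = 1 := by nlinarith [sq_nonneg (taubesR y - 1)]
  apply hc
  rw [mem_taubesCore]
  refine ⟨?_, pow_eq_zero_iff (n := 2) (by norm_num) |>.mp hb, pow_eq_zero_iff (n := 2) (by norm_num) |>.mp hc'⟩
  rw [← taubesR_sq, h1]; norm_num

/-! ### The toroidal frame -/

/-- Reconstruction of a flat vector from its toroidal components (off the axis):
`u = dt(u) ∂_t + da(u) ∂_a + u₂ e₂ + u₃ e₃`, written component-wise. [folklore] -/
theorem frame_reconstruct (y u : EuclideanSpace ℝ (Fin 4)) (hr : 0 < taubesR y) :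
    u 0 = -(y 1) * taubesDt y u + y 0 / taubesR y * taubesDa y u ∧
    u 1 = y 0 * taubesDt y u + y 1 / taubesR y * taubesDa y u := by
  have hr0 : taubesR y ≠ 0 := hr.ne'
  have hsq := taubesR_sq y
  constructor
  · rw [taubesDt, taubesDa]
    field_simp
    linear_combination (u 0) * hsq
  · rw [taubesDt, taubesDa]
    field_simp
    linear_combination (u 1) * hsq

/-- Toroidal components of a vector given in the frame: `dt (E₀ ∂_t + E₁ ∂_a + …) = E₀`,
`da (…) = E₁`. [folklore] -/
theorem frame_components (y : EuclideanSpace ℝ (Fin 4)) (hr : 0 < taubesR y) (E0 E1 E2 E3 : ℝ) :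
    taubesDt y (WithLp.toLp 2 ![-(y 1) * E0 + y 0 / taubesR y * E1, y 0 * E0 + y 1 / taubesR y * E1, E2, E3]) = E0 ∧
    taubesDa y (WithLp.toLp 2 ![-(y 1) * E0 + y 0 / taubesR y * E1, y 0 * E0 + y 1 / taubesR y * E1, E2, E3]) = E1 := by
  have hr0 : taubesR y ≠ 0 := hr.ne'
  have hsq := taubesR_sq y
  constructor
  · simp only [taubesDt, Matrix.cons_val_zero, Matrix.cons_val_one]
    field_simp
    linear_combination (-(E0 * taubesR y)) * hsq
  · simp only [taubesDa, Matrix.cons_val_zero, Matrix.cons_val_one]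
    field_simp
    linear_combination (-E1) * hsq

/-- The toroidal components of `J♭ u`: `dt(J♭u) = E₀`, `da(J♭u) = E₁`, `(J♭u)₂ = E₂`, `(J♭u)₃ = E₃`
with Taubes' formulas. [folklore] -/
theorem taubesJ_components (y u : EuclideanSpace ℝ (Fin 4)) (hr : 0 < taubesR y) :
    taubesDt y (taubesJ y u) =
      (-(taubesR y - 1) * taubesDa y u - y 2 * u 2 + 2 * y 3 * u 3) / taubesGrad y ∧
    taubesDa y (taubesJ y u) =
      ((taubesR y - 1) * taubesDt y u + y 2 * u 3 + 2 * y 3 * u 2) / taubesGrad y ∧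
    (taubesJ y u) 2 = (-(taubesR y - 1) * u 3 + y 2 * taubesDt y u - 2 * y 3 * taubesDa y u) / taubesGrad y ∧
    (taubesJ y u) 3 = ((taubesR y - 1) * u 2 - y 2 * taubesDa y u - 2 * y 3 * taubesDt y u) / taubesGrad y := by
  obtain ⟨h0, h1⟩ := frame_components y hr
    ((-(taubesR y - 1) * taubesDa y u - y 2 * u 2 + 2 * y 3 * u 3) / taubesGrad y)
    (((taubesR y - 1) * taubesDt y u + y 2 * u 3 + 2 * y 3 * u 2) / taubesGrad y)
    ((-(taubesR y - 1) * u 3 + y 2 * taubesDt y u - 2 * y 3 * taubesDa y u) / taubesGrad y)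
    (((taubesR y - 1) * u 2 - y 2 * taubesDa y u - 2 * y 3 * taubesDt y u) / taubesGrad y)
  refine ⟨?_, ?_, ?_, ?_⟩
  · exact h0
  · exact h1
  · rfl
  · rfl

/-! ### `J♭² = −1` -/

/-- **`J♭² = −1` on the punctured tube** (Taubes 1998, §1: `J♭` is an almost complex structure off
the zero circle). [folklore] -/
theorem helper_taubesJ_sq :
    ∀ (δ : ℝ) (y : EuclideanSpace ℝ (Fin 4)), 0 < δ → δ < 1 → y ∈ taubesTube δ → y ∉ taubesCore →
      ∀ u : EuclideanSpace ℝ (Fin 4), taubesJ y (taubesJ y u) = -u := by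
  intro δ y hδ0 hδ hy hc u
  have hr := helper_taubesR_pos δ y hδ0 hδ hy
  have hm := helper_taubesGrad_pos δ y hδ0 hδ hy hc
  have hr0 : taubesR y ≠ 0 := hr.ne'
  have hm0 : taubesGrad y ≠ 0 := hm.ne'
  have hmsq := taubesGrad_sq y
  obtain ⟨hJ0, hJ1, hJ2, hJ3⟩ := taubesJ_components y u hr
  obtain ⟨hu0, hu1⟩ := frame_reconstruct y u hr
  -- toroidal components of `J♭ (J♭ u)`
  obtain ⟨hK0, hK1, hK2, hK3⟩ := taubesJ_components y (taubesJ y u) hr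
  simp only [hJ0, hJ1, hJ2, hJ3] at hK0 hK1 hK2 hK3
  -- they equal `-dt u, -da u, -u₂, -u₃`
  have e0 : taubesDt y (taubesJ y (taubesJ y u)) = - taubesDt y u := by
    rw [hK0]; field_simp; linear_combination (taubesDt y u) * hmsq
  have e1 : taubesDa y (taubesJ y (taubesJ y u)) = - taubesDa y u := by
    rw [hK1]; field_simp; linear_combination (taubesDa y u) * hmsq
  have e2 : (taubesJ y (taubesJ y u)) 2 = - u 2 := by
    rw [hK2]; field_simp; linear_combination (u 2) * hmsq
  have e3 : (taubesJ y (taubesJ y u)) 3 = - u 3 := by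
    rw [hK3]; field_simp; linear_combination (u 3) * hmsq
  obtain ⟨hw0, hw1⟩ := frame_reconstruct y (taubesJ y (taubesJ y u)) hr
  ext i
  fin_cases i
  · show (taubesJ y (taubesJ y u)) 0 = (-u) 0
    rw [hw0, e0, e1, PiLp.neg_apply, hu0]; ring
  · show (taubesJ y (taubesJ y u)) 1 = (-u) 1
    rw [hw1, e0, e1, PiLp.neg_apply, hu1]; ring
  · show (taubesJ y (taubesJ y u)) 2 = (-u) 2
    rw [e2, PiLp.neg_apply]
  · show (taubesJ y (taubesJ y u)) 3 = (-u) 3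
    rw [e3, PiLp.neg_apply]

/-! ### Compatibility and tameness: `ωT(u, J♭ v) = |∇Q| g_tor(u, v)` -/

/-- **`ωT(u, J♭v) = |∇Q| · g_tor(u, v)` on the punctured tube**: Taubes' structure is the
`g_tor`-orthogonal complex structure of the self-dual form `ωT` (Taubes 1998, §1). [folklore] -/
theorem helper_taubesForm_taubesJ :
    ∀ (δ : ℝ) (y : EuclideanSpace ℝ (Fin 4)), 0 < δ → δ < 1 → y ∈ taubesTube δ → y ∉ taubesCore →
      ∀ u v : EuclideanSpace ℝ (Fin 4), taubesForm y u (taubesJ y v) =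
        taubesGrad y * (taubesDt y u * taubesDt y v + taubesDa y u * taubesDa y v + u 2 * v 2 + u 3 * v 3) := by
  intro δ y hδ0 hδ hy hc u v
  have hr := helper_taubesR_pos δ y hδ0 hδ hy
  have hm := helper_taubesGrad_pos δ y hδ0 hδ hy hc
  have hm0 : taubesGrad y ≠ 0 := hm.ne'
  have hmsq := taubesGrad_sq y
  obtain ⟨hJ0, hJ1, hJ2, hJ3⟩ := taubesJ_components y v hr
  simp only [taubesForm, taubesDQ]
  rw [hJ0, hJ1, hJ2, hJ3]
  field_simp
  linear_combination (-(taubesDt y u * taubesDt y v + taubesDa y u * taubesDa y v + u 2 * v 2 + u 3 * v 3)) * hmsq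

/-- A flat vector with vanishing toroidal components vanishes (off the axis). [folklore] -/
theorem eq_zero_of_components (y u : EuclideanSpace ℝ (Fin 4)) (hr : 0 < taubesR y)
    (h0 : taubesDt y u = 0) (h1 : taubesDa y u = 0) (h2 : u 2 = 0) (h3 : u 3 = 0) : u = 0 := by
  obtain ⟨hu0, hu1⟩ := frame_reconstruct y u hr
  ext i
  fin_cases i
  · show u 0 = 0
    rw [hu0, h0, h1]; ring
  · show u 1 = 0
    rw [hu1, h0, h1]; ring
  · exact h2
  · exact h3

/-- **`J♭` is `ωT`-TAME on the punctured tube**: `ωT(u, J♭u) = |∇Q| |u|²_tor > 0` for `u ≠ 0`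
(Taubes 1998, §1). [folklore] -/
theorem helper_taubesForm_tame :
    ∀ (δ : ℝ) (y : EuclideanSpace ℝ (Fin 4)), 0 < δ → δ < 1 → y ∈ taubesTube δ → y ∉ taubesCore →
      ∀ u : EuclideanSpace ℝ (Fin 4), u ≠ 0 → 0 < taubesForm y u (taubesJ y u) := by
  intro δ y hδ0 hδ hy hc u hu
  have hr := helper_taubesR_pos δ y hδ0 hδ hy
  have hm := helper_taubesGrad_pos δ y hδ0 hδ hy hc
  rw [helper_taubesForm_taubesJ δ y hδ0 hδ hy hc u u]
  apply mul_pos hm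
  -- the `g_tor`-norm of a nonzero vector is positive
  rcases lt_or_eq_of_le (add_nonneg (add_nonneg (add_nonneg (mul_self_nonneg (taubesDt y u))
    (mul_self_nonneg (taubesDa y u))) (mul_self_nonneg (u 2))) (mul_self_nonneg (u 3))) with h | h
  · exact h
  · exfalso
    apply hu
    have h0 : taubesDt y u = 0 := by nlinarith [mul_self_nonneg (taubesDt y u), mul_self_nonneg (taubesDa y u), mul_self_nonneg (u 2), mul_self_nonneg (u 3)]
    have h1 : taubesDa y u = 0 := by nlinarith [mul_self_nonneg (taubesDt y u), mul_self_nonneg (taubesDa y u), mul_self_nonneg (u 2), mul_self_nonneg (u 3)]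
    have h2 : u 2 = 0 := by nlinarith [mul_self_nonneg (taubesDt y u), mul_self_nonneg (taubesDa y u), mul_self_nonneg (u 2), mul_self_nonneg (u 3)]
    have h3 : u 3 = 0 := by nlinarith [mul_self_nonneg (taubesDt y u), mul_self_nonneg (taubesDa y u), mul_self_nonneg (u 2), mul_self_nonneg (u 3)]
    exact eq_zero_of_components y u hr h0 h1 h2 h3

/-- **`ωT` is alternating**: `ωT(v, u) = −ωT(u, v)`. [folklore] -/
theorem helper_taubesForm_swap :
    ∀ y u v : EuclideanSpace ℝ (Fin 4), taubesForm y v u = - taubesForm y u v := by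
  intro y u v
  simp only [taubesForm]
  ring

/-! ### `J♭ ∂_t = ∇Q / |∇Q|` and horizontality -/

/-- Extensionality on `ℝ⁴` by the four numeral components. [folklore] -/
theorem euclideanSpace_ext4 {u v : EuclideanSpace ℝ (Fin 4)} (h0 : u 0 = v 0) (h1 : u 1 = v 1)
    (h2 : u 2 = v 2) (h3 : u 3 = v 3) : u = v := by
  ext i
  fin_cases i
  · exact h0
  · exact h1
  · exact h2
  · exact h3

/-- **`J♭ ∂_t = ∇Q/|∇Q|`** on the punctured tube, in flat components:
`J♭ (−y₁, y₀, 0, 0) = |∇Q|⁻¹ (a y₀/r, a y₁/r, b, −2c)` (Taubes 1998, §1). [folklore] -/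
theorem helper_taubesJ_dt :
    ∀ (δ : ℝ) (y : EuclideanSpace ℝ (Fin 4)), 0 < δ → δ < 1 → y ∈ taubesTube δ → y ∉ taubesCore →
      taubesJ y (WithLp.toLp 2 ![-(y 1), y 0, 0, 0]) =
        (taubesGrad y)⁻¹ • WithLp.toLp 2 ![(taubesR y - 1) * y 0 / taubesR y,
          (taubesR y - 1) * y 1 / taubesR y, y 2, -2 * y 3] := by
  intro δ y hδ0 hδ hy hc
  have hr := helper_taubesR_pos δ y hδ0 hδ hy
  have hm := helper_taubesGrad_pos δ y hδ0 hδ hy hc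
  have hr0 : taubesR y ≠ 0 := hr.ne'
  have hm0 : taubesGrad y ≠ 0 := hm.ne'
  have hsq := taubesR_sq y
  -- toroidal components of `∂_t`: `dt = 1`, `da = 0`, `(∂_t)₂ = (∂_t)₃ = 0`
  have ht : taubesDt y (WithLp.toLp 2 ![-(y 1), y 0, 0, 0]) = 1 := by
    simp only [taubesDt, Matrix.cons_val_zero, Matrix.cons_val_one]
    field_simp
    linear_combination (-1 : ℝ) * hsq
  have ha : taubesDa y (WithLp.toLp 2 ![-(y 1), y 0, 0, 0]) = 0 := by
    simp only [taubesDa, Matrix.cons_val_zero, Matrix.cons_val_one]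
    ring
  obtain ⟨hJ0, hJ1, hJ2, hJ3⟩ := taubesJ_components y (WithLp.toLp 2 ![-(y 1), y 0, 0, 0]) hr
  simp only [ht, ha, Matrix.cons_val] at hJ0 hJ1 hJ2 hJ3
  -- compare toroidal components
  obtain ⟨hw0, hw1⟩ := frame_reconstruct y (taubesJ y (WithLp.toLp 2 ![-(y 1), y 0, 0, 0])) hr
  apply euclideanSpace_ext4
  · rw [hw0, hJ0, hJ1]
    simp only [PiLp.smul_apply, smul_eq_mul, Matrix.cons_val]
    field_simp
    ring
  · rw [hw1, hJ0, hJ1]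
    simp only [PiLp.smul_apply, smul_eq_mul, Matrix.cons_val]
    field_simp
    ring
  · rw [hJ2]
    simp only [PiLp.smul_apply, smul_eq_mul, Matrix.cons_val]
    field_simp
    ring
  · rw [hJ3]
    simp only [PiLp.smul_apply, smul_eq_mul, Matrix.cons_val]
    field_simp
    ring

/-- **The horizontal distribution `ker dt ∩ ker dQ` is `J♭`-invariant** on the punctured tube (so the
sheets `{t = t₀, Q = const}` are `J♭`-holomorphic; Taubes 1998, §1). [folklore] -/
theorem helper_taubesJ_horizontal :
    ∀ (δ : ℝ) (y : EuclideanSpace ℝ (Fin 4)), 0 < δ → δ < 1 → y ∈ taubesTube δ → y ∉ taubesCore →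
      ∀ u : EuclideanSpace ℝ (Fin 4), taubesDt y u = 0 → taubesDQ y u = 0 →
        taubesDt y (taubesJ y u) = 0 ∧ taubesDQ y (taubesJ y u) = 0 := by
  intro δ y hδ0 hδ hy hc u ht hQ
  have hr := helper_taubesR_pos δ y hδ0 hδ hy
  have hm := helper_taubesGrad_pos δ y hδ0 hδ hy hc
  have hm0 : taubesGrad y ≠ 0 := hm.ne'
  obtain ⟨hJ0, hJ1, hJ2, hJ3⟩ := taubesJ_components y u hr
  rw [taubesDQ] at hQ ⊢
  constructor
  · rw [hJ0]
    have : -(taubesR y - 1) * taubesDa y u - y 2 * u 2 + 2 * y 3 * u 3 = 0 := by linarith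
    rw [this, zero_div]
  · rw [hJ1, hJ2, hJ3, ht]
    field_simp
    ring

end Summit.SmoothPoincare4.SmoothPoincare4.Cruxes.HyperbolicEnd.TaubesCirclePencil

end
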